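import Literature.Topology.FourManifolds.InteriorDiscs
import Literature.Topology.FourManifolds.BallGluingCharts
import HarnessLib

/-!
# Lifting immersions and smooth embeddings into the interior manifold

Topic `Literature/Topology/FourManifolds`, a complement to `InteriorManifold.lean` and
`InteriorDiscs.lean` (Bröcker–Jänich, *Introduction to Differential Topology* (1982), (13.3):
the interior `M - ∂M` of a manifold with boundary as a manifold WITHOUT boundary, modelled on the
model vector space `E`).  Everything here is PROVED; no named facts.

`InteriorDiscs.lean` lifts a smooth embedding of the model DISC `E → M` to a smooth embedding into
`InteriorManifold I M`.  Here the source is an arbitrary charted space (e.g. a manifold with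
boundary mapped into the interior of another one, as the piece `W` of an attachment `W ∪_ψ X`):

* `InteriorManifold.liftChart e he x₀` — the chart `y ↦ e.extend I y.val` of the interior read
  off ANY chart `e` of the maximal `C^∞` atlas of `M` (`interiorChart x` is the case
  `e = chartAt x`), and `liftChart_mem_maximalAtlas` — it belongs to the maximal atlas of the
  interior (both it and its inverse are `C^∞`, by `contMDiffOn_extend`, `contMDiffOn_extend_symm`
  and `contMDiff_iff_comp_val`).
* `Manifold.IsImmersionAtOfComplement.interiorLift` — if `f : X → M` takes values in the
  interior and is an immersion at `x` (chosen complement `F`), so is its lift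
  `InteriorManifold.lift f _ : X → InteriorManifold I M` (same domain chart, codomain chart
  `liftChart` of the codomain chart, same linear normal form).
* `Manifold.IsSmoothEmbedding.interiorLift` — the lift of a smooth embedding with values in the
  interior is a smooth embedding.
* `Manifold.IsImmersion.isImmersionOfComplement_punit` — an immersion between manifolds whose
  model vector spaces have the same finite dimension is an immersion with the trivial complement
  `PUnit` (the complement of an equidimensional linear normal form is `0`); used to give
  piecewise-defined equidimensional maps a single complement.

## References

* Th. Bröcker, K. Jänich, *Introduction to Differential Topology*, CUP (1982), (13.3).
  [BrockerJanich1982]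
* J. M. Lee, *Introduction to Smooth Manifolds*, 2nd ed. (2013), Thm. 1.46 (smooth invariance of
  the boundary), Ch. 4–5. [LeeSmoothManifolds2013]
-/

open scoped Manifold ContDiff Topology
open Set Function Topology

noncomputable section

namespace Literature.Topology.FourManifolds

universe v

namespace InteriorManifold

variable {E H : Type*} [NormedAddCommGroup E] [NormedSpace ℝ E] [TopologicalSpace H]
  {I : ModelWithCorners ℝ E H} {M : Type*} [TopologicalSpace M] [ChartedSpace H M]
  [IsManifold I ∞ M]

/-! ### Charts of the interior read off charts of the maximal atlas -/

/-- For a chart `e` of the maximal `C^∞` atlas and `u ∈ I.symm ⁻¹' e.target ∩ interior (range I)`, the point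
`(e.extend I).symm u` is an interior point. [cite: LeeSmoothManifolds2013, Thm. 1.46] -/
theorem isInteriorPoint_extend_symm_of_mem_maximalAtlas {e : OpenPartialHomeomorph M H}
    (he : e ∈ IsManifold.maximalAtlas I ∞ M) {u : E}
    (hu : u ∈ I.symm ⁻¹' e.target ∩ interior (range I)) :
    I.IsInteriorPoint ((e.extend I).symm u) := by
  have hu' : (e.extend I).symm u ∈ e.source := by
    rw [e.extend_coe_symm]
    exact e.map_target hu.1
  have hu'' : u ∈ (e.extend I).target := by
    rw [e.extend_target]
    exact ⟨hu.1, interior_subset hu.2⟩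
  refine (isInteriorPoint_iff_of_mem_maximalAtlas (by simp) he hu').2 ?_
  rw [(e.extend I).right_inv hu'']
  exact hu.2

open Classical in
/-- The inverse of `liftChart e he x₀`: `u ↦ (e.extend I).symm u` on
`I.symm ⁻¹' e.target ∩ interior (range I)`, the junk value `x₀` elsewhere. [folklore] -/
def liftChartInv (e : OpenPartialHomeomorph M H) (he : e ∈ IsManifold.maximalAtlas I ∞ M)
    (x₀ : InteriorManifold I M) (u : E) : InteriorManifold I M :=
  if h : u ∈ I.symm ⁻¹' e.target ∩ interior (range I) then
    ⟨(e.extend I).symm u, isInteriorPoint_extend_symm_of_mem_maximalAtlas he h⟩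
  else x₀

/-- On its domain `liftChartInv` is the inverse extended chart. [folklore] -/
theorem liftChartInv_val_of_mem {e : OpenPartialHomeomorph M H}
    (he : e ∈ IsManifold.maximalAtlas I ∞ M) (x₀ : InteriorManifold I M) {u : E}
    (hu : u ∈ I.symm ⁻¹' e.target ∩ interior (range I)) :
    (liftChartInv e he x₀ u).val = (e.extend I).symm u := by
  rw [liftChartInv, dif_pos hu]

/-- **The chart of the interior read off a chart `e` of the maximal atlas of `M`**:
`y ↦ e.extend I y.val` on `val ⁻¹' e.source`, valued in `E`, with target
`I.symm ⁻¹' e.target ∩ interior (range I)` (`interiorChart x` is the case `e = chartAt x`).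
Bröcker–Jänich (1982), (13.3). [cite: BrockerJanich1982, (13.3)] -/
def liftChart (e : OpenPartialHomeomorph M H) (he : e ∈ IsManifold.maximalAtlas I ∞ M)
    (x₀ : InteriorManifold I M) : OpenPartialHomeomorph (InteriorManifold I M) E where
  toFun y := e.extend I y.val
  invFun := liftChartInv e he x₀
  source := val ⁻¹' e.source
  target := I.symm ⁻¹' e.target ∩ interior (range I)
  map_source' y hy := by
    refine ⟨?_, (isInteriorPoint_iff_of_mem_maximalAtlas (by simp) he hy).1 y.property⟩
    simp only [OpenPartialHomeomorph.extend_coe, comp_apply, mem_preimage, I.left_inv]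
    exact e.map_source hy
  map_target' u hu := by
    change (liftChartInv e he x₀ u).val ∈ e.source
    rw [liftChartInv_val_of_mem he x₀ hu, OpenPartialHomeomorph.extend_coe_symm, comp_apply]
    exact e.map_target hu.1
  left_inv' y hy := by
    apply InteriorManifold.ext
    have hy' : e.extend I y.val ∈ I.symm ⁻¹' e.target ∩ interior (range I) := by
      refine ⟨?_, (isInteriorPoint_iff_of_mem_maximalAtlas (by simp) he hy).1 y.property⟩
      simp only [OpenPartialHomeomorph.extend_coe, comp_apply, mem_preimage, I.left_inv]
      exact e.map_source hy
    rw [liftChartInv_val_of_mem he x₀ hy']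
    exact e.extend_left_inv (I := I) hy
  right_inv' u hu := by
    rw [liftChartInv_val_of_mem he x₀ hu]
    refine (e.extend I).right_inv ?_
    rw [e.extend_target]
    exact ⟨hu.1, interior_subset hu.2⟩
  open_source := e.open_source.preimage continuous_val
  open_target := (e.open_target.preimage I.continuous_symm).inter isOpen_interior
  continuousOn_toFun := by
    refine (e.continuousOn_extend (I := I)).comp continuous_val.continuousOn fun y hy => ?_
    rwa [OpenPartialHomeomorph.extend_source]
  continuousOn_invFun := by
    rw [continuousOn_iff_comp_val]
    refine ((e.continuousOn_extend_symm (I := I)).mono ?_).congr ?_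
    · intro u hu
      rw [e.extend_target]
      exact ⟨hu.1, interior_subset hu.2⟩
    · intro u hu
      exact liftChartInv_val_of_mem he x₀ hu

/-- The lifted chart is `y ↦ e.extend I y.val` (definitional). [folklore] -/
@[simp] theorem liftChart_apply {e : OpenPartialHomeomorph M H}
    (he : e ∈ IsManifold.maximalAtlas I ∞ M) (x₀ y : InteriorManifold I M) :
    liftChart e he x₀ y = e.extend I y.val := rfl

/-- The source of the lifted chart (definitional). [folklore] -/
@[simp] theorem liftChart_source {e : OpenPartialHomeomorph M H}
    (he : e ∈ IsManifold.maximalAtlas I ∞ M) (x₀ : InteriorManifold I M) :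
    (liftChart e he x₀).source = val ⁻¹' e.source := rfl

/-- The target of the lifted chart (definitional). [folklore] -/
@[simp] theorem liftChart_target {e : OpenPartialHomeomorph M H}
    (he : e ∈ IsManifold.maximalAtlas I ∞ M) (x₀ : InteriorManifold I M) :
    (liftChart e he x₀).target = I.symm ⁻¹' e.target ∩ interior (range I) := rfl

/-- On its target the inverse of the lifted chart is the inverse extended chart. [folklore] -/
theorem liftChart_symm_apply_val {e : OpenPartialHomeomorph M H}
    (he : e ∈ IsManifold.maximalAtlas I ∞ M) (x₀ : InteriorManifold I M) {u : E}
    (hu : u ∈ (liftChart e he x₀).target) :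
    ((liftChart e he x₀).symm u).val = (e.extend I).symm u :=
  liftChartInv_val_of_mem he x₀ hu

/-- **The lifted chart belongs to the maximal `C^∞` atlas of the interior**: it is `C^∞`
(`(e.extend I) ∘ val`) with `C^∞` inverse (`(e.extend I).symm`, tested after `val`).
[cite: BrockerJanich1982, (13.3)] -/
theorem liftChart_mem_maximalAtlas {e : OpenPartialHomeomorph M H}
    (he : e ∈ IsManifold.maximalAtlas I ∞ M) (x₀ : InteriorManifold I M) :
    liftChart e he x₀ ∈ IsManifold.maximalAtlas 𝓘(ℝ, E) ∞ (InteriorManifold I M) := by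
  rw [IsManifold.mem_maximalAtlas_iff_contMDiffOn]
  constructor
  · have h1 : ContMDiffOn I 𝓘(ℝ, E) ∞ (e.extend I) e.source := e.contMDiffOn_extend he
    exact h1.comp contMDiff_val.contMDiffOn fun y hy => hy
  · have h2 : ContMDiffOn 𝓘(ℝ, E) I ∞ (e.extend I).symm (I '' e.target) :=
      contMDiffOn_extend_symm he
    have h3 : ContMDiffOn 𝓘(ℝ, E) 𝓘(ℝ, E) ((⊤ : ℕ∞) : ℕ∞ω) (liftChart e he x₀).symm
        (liftChart e he x₀).target := by
      rw [contMDiffOn_iff_comp_val]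
      refine (h2.mono ?_).congr ?_
      · rintro u ⟨hu₁, hu₂⟩
        exact ⟨I.symm u, hu₁, I.right_inv (interior_subset hu₂)⟩
      · intro u hu
        exact liftChart_symm_apply_val he x₀ hu
    exact h3

/-! ### Lifting immersions and embeddings -/

section Lift

variable {F : Type*} [NormedAddCommGroup F] [NormedSpace ℝ F]
  {E' H' : Type*} [NormedAddCommGroup E'] [NormedSpace ℝ E'] [TopologicalSpace H']
  {J : ModelWithCorners ℝ E' H'} {X : Type*} [TopologicalSpace X] [ChartedSpace H' X]

/-- **An immersion with values in the interior lifts to an immersion into the interior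
manifold** (chosen complement): same domain chart, the lifted codomain chart, the same linear
normal form. [cite: BrockerJanich1982, (13.3)] -/
theorem _root_.Manifold.IsImmersionAtOfComplement.interiorLift {f : X → M} {x : X}
    (hf : Manifold.IsImmersionAtOfComplement F J I ∞ f x) (hint : ∀ y, I.IsInteriorPoint (f y)) :
    Manifold.IsImmersionAtOfComplement F J 𝓘(ℝ, E) ∞ (lift f hint) x := by
  set x₀ : InteriorManifold I M := ⟨f x, hint x⟩
  have hcont : ContinuousAt (lift f hint) x := by
    rw [ContinuousAt, isInducing_val.nhds_eq_comap, Filter.tendsto_comap_iff]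
    exact hf.continuousAt
  refine Manifold.IsImmersionAtOfComplement.mk_of_continuousAt hcont hf.equiv hf.domChart
    (liftChart hf.codChart hf.codChart_mem_maximalAtlas x₀) hf.mem_domChart_source
    hf.mem_codChart_source hf.domChart_mem_maximalAtlas
    (liftChart_mem_maximalAtlas hf.codChart_mem_maximalAtlas x₀) ?_
  intro u hu
  have h := hf.writtenInCharts hu
  simp only [comp_apply] at h ⊢
  rw [← h, OpenPartialHomeomorph.extend_coe, comp_apply, modelWithCornersSelf_coe, id_eq,
    liftChart_apply]
  rfl

/-- **A smooth embedding with values in the interior lifts to a smooth embedding into the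
interior manifold.** [cite: BrockerJanich1982, (13.3)] -/
theorem _root_.Manifold.IsSmoothEmbedding.interiorLift {f : X → M}
    (hf : Manifold.IsSmoothEmbedding J I ∞ f) (hint : ∀ y, I.IsInteriorPoint (f y)) :
    Manifold.IsSmoothEmbedding J 𝓘(ℝ, E) ∞ (lift f hint) := by
  obtain ⟨⟨F', _, _, hF⟩, hemb⟩ := hf
  have hcont : Continuous (lift f hint) := continuous_iff_comp_val.2 hemb.continuous
  exact ⟨Manifold.IsImmersionOfComplement.isImmersion fun y => (hF y).interiorLift hint,
    .of_comp hcont continuous_val (by rw [val_comp_lift]; exact hemb)⟩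

end Lift

end InteriorManifold

/-! ### Equidimensional immersions have trivial complement -/

section PUnitComplement

variable {E : Type*} [NormedAddCommGroup E] [NormedSpace ℝ E] [FiniteDimensional ℝ E]
  {E' : Type*} [NormedAddCommGroup E'] [NormedSpace ℝ E'] [FiniteDimensional ℝ E']
  {H : Type*} [TopologicalSpace H] {H' : Type*} [TopologicalSpace H']
  {I : ModelWithCorners ℝ E H} {J : ModelWithCorners ℝ E' H'}
  {M : Type*} [TopologicalSpace M] [ChartedSpace H M]
  {N : Type*} [TopologicalSpace N] [ChartedSpace H' N]
  {n : ℕ∞ω}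

/-- If `E × F ≃L E'` and `dim E = dim E' < ∞` then `F` is a subsingleton (`dim F = 0`).
[folklore] -/
theorem subsingleton_of_prod_equiv_of_finrank_eq {F : Type*} [NormedAddCommGroup F]
    [NormedSpace ℝ F] (e : (E × F) ≃L[ℝ] E') (h : Module.finrank ℝ E = Module.finrank ℝ E') :
    Subsingleton F := by
  have hinj : Function.Injective ((e : (E × F) →ₗ[ℝ] E').comp (LinearMap.inr ℝ E F)) :=
    e.injective.comp LinearMap.inr_injective
  haveI : Module.Finite ℝ F := Module.Finite.of_injective _ hinj
  have h1 : Module.finrank ℝ (E × F) = Module.finrank ℝ E' := e.toLinearEquiv.finrank_eq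
  rw [Module.finrank_prod] at h1
  have h2 : Module.finrank ℝ F = 0 := by omega
  exact Module.finrank_zero_iff.1 h2

/-- A continuous linear equivalence from a subsingleton normed space to `PUnit`. [folklore] -/
def continuousLinearEquivPUnitOfSubsingleton (F : Type*) [NormedAddCommGroup F]
    [NormedSpace ℝ F] [Subsingleton F] : F ≃L[ℝ] PUnit.{v + 1} where
  toFun _ := PUnit.unit
  invFun _ := 0
  map_add' _ _ := rfl
  map_smul' _ _ := rfl
  left_inv _ := Subsingleton.elim _ _
  right_inv _ := Subsingleton.elim _ _
  continuous_toFun := continuous_const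
  continuous_invFun := continuous_const

/-- **An immersion at a point between manifolds of the same finite dimension has trivial
complement**: from any chosen complement `F` (`E × F ≃L E'` forces `F = 0`) pass to `PUnit`.
[folklore] -/
theorem _root_.Manifold.IsImmersionAtOfComplement.punit_of_finrank_eq {F : Type*}
    [NormedAddCommGroup F] [NormedSpace ℝ F] {f : M → N} {x : M}
    (hf : Manifold.IsImmersionAtOfComplement F I J n f x)
    (h : Module.finrank ℝ E = Module.finrank ℝ E') :
    Manifold.IsImmersionAtOfComplement PUnit.{v + 1} I J n f x := by
  haveI : Subsingleton F := subsingleton_of_prod_equiv_of_finrank_eq hf.equiv h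
  exact hf.trans_F (continuousLinearEquivPUnitOfSubsingleton F)

/-- **An immersion between manifolds of the same finite dimension is an immersion with the
trivial complement `PUnit`.** [folklore] -/
theorem _root_.Manifold.IsImmersion.isImmersionOfComplement_punit {f : M → N}
    (hf : Manifold.IsImmersion I J n f) (h : Module.finrank ℝ E = Module.finrank ℝ E') :
    Manifold.IsImmersionOfComplement PUnit.{v + 1} I J n f := by
  obtain ⟨F, _, _, hF⟩ := hf
  exact fun x => (hF x).punit_of_finrank_eq h

/-- A smooth embedding between manifolds of the same finite dimension is an immersion at every
point with the trivial complement `PUnit`. [folklore] -/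
theorem _root_.Manifold.IsSmoothEmbedding.isImmersionAtOfComplement_punit {f : M → N}
    (hf : Manifold.IsSmoothEmbedding I J n f) (h : Module.finrank ℝ E = Module.finrank ℝ E')
    (x : M) : Manifold.IsImmersionAtOfComplement PUnit.{v + 1} I J n f x :=
  hf.isImmersion.isImmersionOfComplement_punit h x

end PUnitComplement

end Literature.Topology.FourManifolds

end
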